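import Literature.MathematicalPhysics.QuantumFieldTheory.Balaban1983to89.T3MinimiserStabilityReduction
import Literature.MathematicalPhysics.QuantumFieldTheory.Balaban1983to89.T3PrintedRegularMinimiser
import Literature.MathematicalPhysics.QuantumFieldTheory.Balaban1983to89.T3OrbitAverage
import Literature.MathematicalPhysics.QuantumFieldTheory.Balaban1983to89.B12ContinuousTransportInvariance
import Literature.MathematicalPhysics.QuantumFieldTheory.Balaban1983to89.Node00.CanonicalTransportOfRecord
import Literature.MathematicalPhysics.QuantumFieldTheory.Balaban1983to89.T3InteriorExcision
import Summits.QuantumFields.YangMills.Theorems.FluctuationComparisonRegPrIntLSupTailReduction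
import Summits.QuantumFields.YangMills.Theorems.FluctuationComparisonRegPrIntLSupTailDepthInduction
import Summits.QuantumFields.YangMills.Theorems.FluctuationComparisonRegPrIntLWreg
import HarnessLib

/-!
# LINE g22-4 «persistence_geometry» — GEOMETRY VERSUS MEASURE: one-level interior persistence PERS₁∘ from a DETERMINISTIC interior section of the averaging
# map (GEOM∘) and the `K`-uniform mass of link-tubes around small-field sections (TUBE∘); the plaquette Lipschitz bound PROVED
# (ideator `ym-r3-idea-1` g22, LENS «control»; companion of LINE g22-2 `Lines/persistence_floor.lean`)

Crux of record: `stmt-QuantumFields-20520` = `Summit.QuantumFields.YangMills.Theses.UnitScaleTilt.FluctuationComparisonRegPrIntL`.  Target concluded BY NAME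
here: this file's `OneLevelPersistenceIntCan` (PERS₁∘) — the text of LINE g22-2 `Lines/persistence_floor.lean` §2 (l.173–181) BYTE-IDENTICAL, so that in any file
seeing both declarations the bridge is `Iff.rfl`; g22-2's PROVED `goodHistoryPositiveInt_of_persistence_multiStep : PERS₁∘ → MSTEP∘ → POS∘`, g22-3's PROVED
`multiStepTail_of_plaqTail : PLAQTAIL∘ → MSTEP∘`, g22-1's PROVED `largeFieldFourPtInt_of_rows` and interior_table then carry it to LFR♯ᶜ∘ and S2β, the registry
(v11.4 of record) to the crux.  With this file the leaf PERS₁∘ of the organ's net is REPLACED by two rows of different nature — one DETERMINISTIC (geometry of the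
averaging map on the interior window, decidable in its linearisation), one MEASURE-THEORETIC (`K`-uniform positivity of tube masses, Bałaban's small-field
stability) — so the organ LFR♯ᶜ∘ rests on 1L4ᶜ∘, H4ᶜ∘, CRUDELOC, PLAQTAIL∘, GEOM∘, TUBE∘.  The registry is FROZEN (RULING №36∕37∕39): PUBLISHED organ-level line,
NOT registered; no `skeleton check` from this seat.

THE LEVER (lens «control» — separate WHERE from HOW MUCH).  PERS₁∘ asks, for each window level `J`, a floor `q_J > 0`, UNIFORM IN THE RUN LENGTH `K`, of the
conditional probability that the run's level `J+1` lies in the interior window `W_{J+1}(c·b₀)` given an interior level-`J` event `B ⊆ W_J(c·b₀)`.  Its two recorded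
risks (g22-2 card, critic #416 P2) are of different kinds: (ii) «the infimum over interior data `U` up to the CLOSED window edge» is GEOMETRY — does every interior
datum `U` have level-`(J+1)` preimages inside the interior window, with a margin? — and (i) «`K`-uniform lower bounds of the conditional law» is MEASURE.  The line
separates them with one object, a SECTION `σ : W_J(c·b₀) → level J+1` of the one-step averaging (`D_{J,J+1}(σ U) = U`), and one elementary inequality (PROVED §3,
`dist1_plaqHol_lt_of_linkClose`): on the `r`-LINK-TUBE `{V : |σ(U)(b)⁻¹V(b) − 1| < r ∀ b}` every plaquette satisfies `|V(∂p) − 1| < |σ(U)(∂p) − 1| + 4r` (the four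
perturbed bond variables conjugated into place: `GaugeGroup.dist1_mul_le ∕ dist1_conj ∕ dist1_inv` and a free-group identity).  Hence:
  GEOM∘ `InteriorSectionCan` (NEW, deterministic): a MEASURABLE section `σ` over the interior window whose values have plaquettes `< θ_{J+1}(c·b₀) − 4r` for some
  `r = r(F, γ, J) > 0` — the ℓ^∞ DE-AVERAGING statement «`C^∞(L) < L^{3∕2}`» (an interior datum with plaquettes `< c·θ_J` has a preimage with plaquettes
  `< c·θ_{J+1} ≈ c·θ_J·L^{−1∕2}`, whereas a preimage spreading the curvature evenly has plaquettes `≈ C^∞·c·θ_J·L^{−2}`); NOT the fibre MINIMISER — its constant is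
  R3-FLIN's `C(3) = 8.64 > 3^{3∕2} = 5.20` (the minimiser of an edge datum lands at `1.66·c`, OUTSIDE the level-`(J+1)` interior: the g22-2 card's mechanism), but
  the ℓ^∞-optimal (Whitney-type) preimage, sealed `C^∞(3) ∈ [1, 3]` (g22-2 card falsifier (a), instrument LP, not run);
  TUBE∘ `SectionTubeMassIntCan` (NEW, measure): for EVERY `r > 0` and EVERY measurable section `σ` over the interior window with small-field values
  (`W_{J+1}(b₀)`), a floor `q = q(F, γ, J, r, σ) > 0` with `q·Gibbs_K(D_{J,K}⁻¹B) ≤ Gibbs_K(D_{J,K}⁻¹B ∩ {r-tube of σ(D_{J,K}V) around D_{J+1,K}V})` for every run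
  `K ≥ J+1` and every measurable interior `B` — the conditional law of level `J+1` given the level-`J` datum CHARGES EVERY SMALL-FIELD TUBE AROUND THE FIBRE,
  uniformly in the cutoff: the small-field effective density after `K − J − 1` steps is bounded BELOW (`e^{−β_{J+1}·Wilson − E·Vol}`) and the fibre partition
  function ABOVE (`e^{+E·Vol}`), [Balaban1985UV3] (7) p.257, (38)–(40) p.266 — positivity with constants after `(F, γ, J)`, no rate, no window geometry.
PERS₁∘ ⟸ GEOM∘ + TUBE∘ (PROVED §4 `oneLevelPersistence_of_geom_tube`): the tube event around `σ(D_J V)` forces `D_{J+1}V ∈ W_{J+1}(c·b₀)` by the Lipschitz bound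
and GEOM∘'s margin; TUBE∘'s admissibility of `σ` (section identity, small-field values) is supplied by GEOM∘ (`θ_{J+1}(c·b₀) − 4r ≤ θ_{J+1}(b₀)`, ✓`θBal_mul_le`).

THE LINE.  PERS₁∘ ⟸ (PROVED) GEOM∘ `InteriorSectionCan` + TUBE∘ `SectionTubeMassIntCan`.  STUBS (2, §5): GEOM∘, TUBE∘.  Unique concluder
`oneLevelPersistenceIntCan_of_stubs : OneLevelPersistenceIntCan`.  `lean check`: rc 0, sorries = the 2 stubs, 0 elsewhere.

HONEST STATUS.  Nothing of Bałaban's is asserted; R3-FLIN ∕ FL-B ∕ FL-N ∕ FL-2 are toy letters (GUIDANCE); GEOM∘ ∕ TUBE∘ ∕ PERS₁∘ ∕ POS∘ ∕ LFR♯ᶜ∘ ∕ S2β ∕ 20520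
are NOT proved; `YM3TorusSU2` is NOT proved; rung R3 — NOT d = 4, NOT infinite volume, NOT a mass gap, NOT Clay; no summit is proved by a line.
References: [Balaban1985UV3] (7) p.257, (38)–(41) p.266; [Balaban1985Averaging] (3), (8)–(10), (19) pp.18–21, Prop. 1; [Balaban1985Variational] Thm 1 (8)–(10)
p.279; [Balaban1987RG1] (0.18) p.255; [Balaban1985RegularSpaces] §1.
-/

open MeasureTheory Filter Topology Set
open scoped ENNReal NNReal BigOperators
open Literature.MathematicalPhysics.QuantumFieldTheory.Balaban1983to89
open Literature.MathematicalPhysics.QuantumFieldTheory.Balaban1983to89.T3ContinuumYM3Torus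
open Literature.MathematicalPhysics.QuantumFieldTheory.Balaban1983to89.T3NestedUnitLaws
open Literature.MathematicalPhysics.QuantumFieldTheory.Balaban1983to89.T3UnitLawDensityEML
open Literature.MathematicalPhysics.QuantumFieldTheory.Balaban1983to89.T3UnitScaleTilt
open Literature.MathematicalPhysics.QuantumFieldTheory.Balaban1983to89.T3TiltDescent
open Literature.MathematicalPhysics.QuantumFieldTheory.Balaban1983to89.T3PrintedRegularMinimiser
open Literature.MathematicalPhysics.QuantumFieldTheory.Balaban1983to89.T3ConstrainedMinimiser (fibre)
open Literature.MathematicalPhysics.QuantumFieldTheory.Balaban1983to89.T3LevelShift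
open Literature.MathematicalPhysics.QuantumFieldTheory.Balaban1983to89.Missing
open Literature.MathematicalPhysics.QuantumFieldTheory.Balaban1983to89.T4Continuum
open Literature.MathematicalPhysics.QuantumFieldTheory.Balaban1983to89.T3DescentFibreTower
open scoped Literature.MathematicalPhysics.QuantumFieldTheory.Balaban1983to89.T3OrbitAverage
open Literature.MathematicalPhysics.QuantumFieldTheory.Balaban1983to89.T3InteriorExcision (θBal_mul θBal_mul_le)

noncomputable section

namespace Summit.QuantumFields.YangMills.Cruxes.FluctuationComparisonRegPrIntL.RunPairOrgan.PersistenceGeometry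

/-! ## §1 THE TARGET ROW, VERBATIM (LINE g22-2 `Lines/persistence_floor.lean` §2 l.173–181): PERS₁∘ -/

section Rows

/-- **PERS₁∘ · ONE-LEVEL INTERIOR PERSISTENCE, POSITIVE FLOOR, ALL RUNS** (`OneLevelPersistenceIntCan`): for every window level `J` there is `q_J > 0` (chosen
AFTER `F, γ, J`: positivity, no rate, no uniformity in `J`) such that for every run `K ≥ J + 1` and every measurable `B` inside the INTERIOR level-`J` window
`W_J(c·b₀)`: `q_J·Gibbs_K(D_{J,K}⁻¹B) ≤ Gibbs_K(D_{J,K}⁻¹B ∩ D_{J+1,K}⁻¹ W_{J+1}(c·b₀))` — given an interior level-`J` event, the run's next level lies in ITS interior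
window with conditional probability at least `q_J`, UNIFORMLY IN THE RUN LENGTH `K`.  The mechanism: the one-step background of an interior datum lies inside the full
window `W_{J+1}(b₀)` (interior price `c < c_max(L)`, FL-B) but — at the edge of `W_J(c·b₀)` — at `≈ c·θ_{J+1}∕c_max(L)` OUTSIDE the level-`(J+1)` interior when
`c_max(L) < 1` (L = 3, 5): landing in the interior then costs a Gaussian fluctuation of relative size `1 − c_max`, i.e. `q_J ≍ β_{J+1}^{−κ}` — ALLOWED, since `q_J` is
chosen after `J`; what is asked uniformly is only the run length `K`, i.e. the UV stability of the conditional law of level `J+1` given level `J` as `K → ∞`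
(Bałaban's effective densities at fixed height converge).  WHY IT MIGHT FAIL: (i) for `K > J + 1` the level-`(J+1)` marginal of the fibre measure is the one-step
fibre law tilted by the deeper effective density `exp(−A_{J+1,K})`; a `K`-uniform LOWER bound of its mass on the interior fibre portion needs two-sided density
bounds at height `K − J − 1` on the SMALL-field region (UV stability (7) gives them; large-field contributions only help a lower bound if non-negative — they are);
(ii) the infimum over interior data `U` (conditioning on arbitrarily small `B`) needs continuity of the conditional law in `U` on the CLOSED interior window
(WREG-type regularity) — at the window's edge included. [cite: Balaban1985UV3, (7) p.257 and (38)-(40) p.266; Balaban1985Averaging, (10) p.19 and Prop. 1;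
Balaban1985Variational, Thm 1 (8)-(10) p.279] -/
def OneLevelPersistenceIntCan : Prop :=
  ∀ (L : ℕ), ∃ c₀ : ℝ, 0 < c₀ ∧ c₀ ≤ 1 ∧ ∀ (c : ℝ), 0 < c → c ≤ c₀ → ∃ pS : ℝ, ∀ (b₀ p₀ : ℝ), 0 < b₀ → pS ≤ p₀ → 0 < p₀ →
    ∃ γ₁ : ℝ, 0 < γ₁ ∧ ∀ (F : T3Family) (γ : ℝ), F.L = L → 0 < γ → γ ≤ γ₁ →
      ∀ (J : ℕ), ∃ q : ℝ, 0 < q ∧ ∀ (K : ℕ) (hJK : J + 1 ≤ K)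
        (B : Set (GaugeField (F.P J) 0 (Matrix.specialUnitaryGroup (Fin 2) ℂ))), MeasurableSet B →
          B ⊆ {U | PlaqSmall (θBal F.L γ (c * b₀) p₀ J) U} →
          ENNReal.ofReal q * gibbsK F ℰp γ K (descendTo F ℰp J K ((Nat.le_succ J).trans hJK) ⁻¹' B) ≤
            gibbsK F ℰp γ K (descendTo F ℰp J K ((Nat.le_succ J).trans hJK) ⁻¹' B ∩
              descendTo F ℰp (J + 1) K hJK ⁻¹' {V | PlaqSmall (θBal F.L γ (c * b₀) p₀ (J + 1)) V})


/-! ## §2 THE NEW ROWS: GEOM∘ (deterministic interior section) and TUBE∘ (`K`-uniform tube mass) -/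

/-- **GEOM∘ · AN INTERIOR SECTION OF THE ONE-STEP AVERAGING WITH A PLAQUETTE MARGIN** (`InteriorSectionCan`, NEW, DETERMINISTIC): in the shared shape (`∀ L, ∃ c₀,
… ∀ c ≤ c₀, ∃ pS, ∀ b₀ p₀, … ∃ γ₁, ∀ F γ, …`), for every window level `J` there are a margin `r > 0` and a MEASURABLE map `σ` from level-`J` to level-`(J+1)`
configurations such that for every interior datum `U ∈ W_J(c·b₀)`: `D_{J,J+1}(σ U) = U` (a section of the one-step averaging `descendTo … J (J+1)`) and EVERY
plaquette of `σ U` is `< θ_{J+1}(c·b₀) − 4r` (inside the level-`(J+1)` interior window with room for an `r`-link-tube, ✓`dist1_plaqHol_lt_of_linkClose`).  THE NEW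
OBJECT: the ℓ^∞ de-averaging constant `C^∞(L) := sup_U min {‖∂A‖_∞ : A averages to U}·L²∕‖∂U‖_∞` (linearised), to be compared with `L^{3∕2}` (the window ratio
`θ_{J+1}∕θ_J = L^{−1∕2}·[(1 + log g_{J+1}⁻¹)∕(1 + log g_J⁻¹)]^{p₀} ≥ L^{−1∕2}`); the fibre MINIMISER does NOT serve at L = 3 (R3-FLIN `C(3) = 8.64 > 5.20`), an
evenly spreading (Whitney-type) preimage should (`C^∞(3)` sealed in `[1, 3]`).  WHY IT MIGHT FAIL: (i) `C^∞(3) ≥ 3^{3∕2}` after all (LP-decidable; sealed against);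
(ii) the NONLINEAR section: an exact preimage under Bałaban's covariant average for EVERY `U` of the window — plaquettes small but bond variables and torus
holonomies arbitrary — measurable in `U` up to the closed edge (gauge covariance of the average + roots along lines + an inverse-function correction at small
`γ`; the construction, not an estimate, is the work). [cite: Balaban1985Averaging, (8)-(10) p.19 and Prop. 1; Balaban1985Variational, Thm 1 (8)-(10) p.279;
Balaban1985RegularSpaces, §1] -/
def InteriorSectionCan : Prop :=
  ∀ (L : ℕ), ∃ c₀ : ℝ, 0 < c₀ ∧ c₀ ≤ 1 ∧ ∀ (c : ℝ), 0 < c → c ≤ c₀ → ∃ pS : ℝ, ∀ (b₀ p₀ : ℝ), 0 < b₀ → pS ≤ p₀ → 0 < p₀ →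
    ∃ γ₁ : ℝ, 0 < γ₁ ∧ ∀ (F : T3Family) (γ : ℝ), F.L = L → 0 < γ → γ ≤ γ₁ →
      ∀ (J : ℕ), ∃ r : ℝ, 0 < r ∧
        ∃ σ : GaugeField (F.P J) 0 (Matrix.specialUnitaryGroup (Fin 2) ℂ) → GaugeField (F.P (J + 1)) 0 (Matrix.specialUnitaryGroup (Fin 2) ℂ),
          Measurable σ ∧ ∀ U : GaugeField (F.P J) 0 (Matrix.specialUnitaryGroup (Fin 2) ℂ), PlaqSmall (θBal F.L γ (c * b₀) p₀ J) U →
            descendTo F ℰp J (J + 1) (Nat.le_succ J) (σ U) = U ∧ PlaqSmall (θBal F.L γ (c * b₀) p₀ (J + 1) - 4 * r) (σ U)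

/-- **TUBE∘ · THE CONDITIONAL LAW OF THE NEXT LEVEL CHARGES EVERY SMALL-FIELD TUBE AROUND THE FIBRE, UNIFORMLY IN THE RUN** (`SectionTubeMassIntCan`, NEW,
MEASURE): in the shared shape, for every window level `J`, every radius `r > 0` and every MEASURABLE section `σ` of the one-step averaging over the interior window
with SMALL-FIELD values (`σ U ∈ W_{J+1}(b₀)` for `U ∈ W_J(c·b₀)`) there is `q > 0` (chosen after `F, γ, J, r, σ`: positivity, no rate) such that for every run
`K ≥ J + 1` and every measurable `B ⊆ W_J(c·b₀)`: `q·Gibbs_K(D_{J,K}⁻¹B) ≤ Gibbs_K(D_{J,K}⁻¹B ∩ {V : |σ(D_{J,K}V)(b)⁻¹·(D_{J+1,K}V)(b) − 1| < r ∀ bonds b})` — the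
`r`-link-tube around the section's point ON THE FIBRE of the datum carries conditional mass `≥ q`, UNIFORMLY IN `K`.  Content: after `K − J − 1` renormalization
steps the effective density of level `J+1` is bounded BELOW on small fields (`exp(−β_{J+1}·Wilson − E·Vol)`, the small-field effective action's bounded analytic
corrections) and the fibre partition function ABOVE (`exp(+E·Vol)`, ultraviolet stability) — both uniformly in `K`, constants extensive and `β_{J+1}`-dependent (all
fixed after `F, γ, J`).  No window geometry, no rate: pure positivity of Bałaban's conditional small-field law at fixed height as the cutoff is removed.  WHY IT MIGHT
FAIL: (i) the LOWER density bound needs the complete small-field analysis at height `K − J − 1` (analyticity domains, [Balaban1987RG1]) — print gives it, size XL;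
(ii) the fibre geometry (fibre volume of an `r`-tube portion) must be bounded below uniformly in `U` up to the closed window edge — regularity of the averaging map
on regular configurations ([Balaban1985Averaging] Prop. 1); (iii) large-field contributions enter only the partition function's UPPER bound ((7) covers them).
[cite: Balaban1985UV3, (7) p.257 and (38)-(40) p.266; Balaban1987RG1, (0.18)-(0.22) p.255; Balaban1985Averaging, Prop. 1 p.22] -/
def SectionTubeMassIntCan : Prop :=
  ∀ (L : ℕ), ∃ c₀ : ℝ, 0 < c₀ ∧ c₀ ≤ 1 ∧ ∀ (c : ℝ), 0 < c → c ≤ c₀ → ∃ pS : ℝ, ∀ (b₀ p₀ : ℝ), 0 < b₀ → pS ≤ p₀ → 0 < p₀ →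
    ∃ γ₁ : ℝ, 0 < γ₁ ∧ ∀ (F : T3Family) (γ : ℝ), F.L = L → 0 < γ → γ ≤ γ₁ →
      ∀ (J : ℕ) (r : ℝ), 0 < r →
        ∀ σ : GaugeField (F.P J) 0 (Matrix.specialUnitaryGroup (Fin 2) ℂ) → GaugeField (F.P (J + 1)) 0 (Matrix.specialUnitaryGroup (Fin 2) ℂ), Measurable σ →
          (∀ U : GaugeField (F.P J) 0 (Matrix.specialUnitaryGroup (Fin 2) ℂ), PlaqSmall (θBal F.L γ (c * b₀) p₀ J) U →
            descendTo F ℰp J (J + 1) (Nat.le_succ J) (σ U) = U ∧ PlaqSmall (θBal F.L γ b₀ p₀ (J + 1)) (σ U)) →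
          ∃ q : ℝ, 0 < q ∧ ∀ (K : ℕ) (hJK : J + 1 ≤ K)
            (B : Set (GaugeField (F.P J) 0 (Matrix.specialUnitaryGroup (Fin 2) ℂ))), MeasurableSet B →
              B ⊆ {U | PlaqSmall (θBal F.L γ (c * b₀) p₀ J) U} →
              ENNReal.ofReal q * gibbsK F ℰp γ K (descendTo F ℰp J K ((Nat.le_succ J).trans hJK) ⁻¹' B) ≤
                gibbsK F ℰp γ K (descendTo F ℰp J K ((Nat.le_succ J).trans hJK) ⁻¹' B ∩
                  {V | ∀ b : PBond (F.P (J + 1)) 0,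
                    dist1 ((σ (descendTo F ℰp J K ((Nat.le_succ J).trans hJK) V) b)⁻¹ *
                      descendTo F ℰp (J + 1) K hJK V b) < r})

end Rows

/-! ## §3 THE PLAQUETTE LIPSCHITZ BOUND ON A LINK-TUBE (PROVED, any gauge group) -/

section Lipschitz

variable {P : Params} {j : ℕ} {G : Type*} [GaugeGroup G]

/-- A free-group identity: the plaquette word in the `vᵢ` is the plaquette word in the `wᵢ` preceded by three conjugates of (products of) the relative
variables `wᵢ⁻¹vᵢ`. [folklore] -/
theorem plaqWord_perturb (w₁ w₂ w₃ w₄ v₁ v₂ v₃ v₄ : G) :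
    v₁ * v₂ * v₃⁻¹ * v₄⁻¹ =
      (w₁ * (w₁⁻¹ * v₁) * w₁⁻¹) * ((w₁ * w₂) * ((w₂⁻¹ * v₂) * (w₃⁻¹ * v₃)⁻¹) * (w₁ * w₂)⁻¹) *
        ((w₁ * w₂ * w₃⁻¹) * (w₄⁻¹ * v₄)⁻¹ * (w₁ * w₂ * w₃⁻¹)⁻¹) * (w₁ * w₂ * w₃⁻¹ * w₄⁻¹) := by
  group

/-- The word estimate: if `|wᵢ⁻¹vᵢ − 1| < r` for the four letters then `|v₁v₂v₃⁻¹v₄⁻¹ − 1| < |w₁w₂w₃⁻¹w₄⁻¹ − 1| + 4r` (`dist1` sub-multiplicative, conjugation-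
and inversion-invariant: the `GaugeGroup` axioms, B7 (19)). [cite: Balaban1985Averaging, (19) p.21] -/
theorem dist1_word_lt_of_close (w₁ w₂ w₃ w₄ v₁ v₂ v₃ v₄ : G) {r : ℝ}
    (h₁ : dist1 (w₁⁻¹ * v₁) < r) (h₂ : dist1 (w₂⁻¹ * v₂) < r) (h₃ : dist1 (w₃⁻¹ * v₃) < r) (h₄ : dist1 (w₄⁻¹ * v₄) < r) :
    dist1 (v₁ * v₂ * v₃⁻¹ * v₄⁻¹) < dist1 (w₁ * w₂ * w₃⁻¹ * w₄⁻¹) + 4 * r := by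
  rw [plaqWord_perturb w₁ w₂ w₃ w₄ v₁ v₂ v₃ v₄]
  have e1 : dist1 (w₁ * (w₁⁻¹ * v₁) * w₁⁻¹) = dist1 (w₁⁻¹ * v₁) := GaugeGroup.dist1_conj _ _
  have e2 : dist1 ((w₁ * w₂) * ((w₂⁻¹ * v₂) * (w₃⁻¹ * v₃)⁻¹) * (w₁ * w₂)⁻¹) ≤ dist1 (w₂⁻¹ * v₂) + dist1 (w₃⁻¹ * v₃) := by
    rw [GaugeGroup.dist1_conj]
    calc dist1 ((w₂⁻¹ * v₂) * (w₃⁻¹ * v₃)⁻¹) ≤ dist1 (w₂⁻¹ * v₂) + dist1 ((w₃⁻¹ * v₃)⁻¹) := GaugeGroup.dist1_mul_le _ _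
      _ = dist1 (w₂⁻¹ * v₂) + dist1 (w₃⁻¹ * v₃) := by rw [GaugeGroup.dist1_inv]
  have e3 : dist1 ((w₁ * w₂ * w₃⁻¹) * (w₄⁻¹ * v₄)⁻¹ * (w₁ * w₂ * w₃⁻¹)⁻¹) = dist1 (w₄⁻¹ * v₄) := by
    rw [GaugeGroup.dist1_conj, GaugeGroup.dist1_inv]
  -- peel the word from the right with `dist1 (g h) ≤ dist1 g + dist1 h`
  set X₁ := w₁ * (w₁⁻¹ * v₁) * w₁⁻¹
  set X₂ := (w₁ * w₂) * ((w₂⁻¹ * v₂) * (w₃⁻¹ * v₃)⁻¹) * (w₁ * w₂)⁻¹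
  set X₃ := (w₁ * w₂ * w₃⁻¹) * (w₄⁻¹ * v₄)⁻¹ * (w₁ * w₂ * w₃⁻¹)⁻¹
  set X₄ := w₁ * w₂ * w₃⁻¹ * w₄⁻¹
  have hm : dist1 (X₁ * X₂ * X₃ * X₄) ≤ dist1 X₁ + dist1 X₂ + dist1 X₃ + dist1 X₄ :=
    calc dist1 (X₁ * X₂ * X₃ * X₄) ≤ dist1 (X₁ * X₂ * X₃) + dist1 X₄ := GaugeGroup.dist1_mul_le _ _
      _ ≤ dist1 (X₁ * X₂) + dist1 X₃ + dist1 X₄ := by gcongr; exact GaugeGroup.dist1_mul_le _ _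
      _ ≤ dist1 X₁ + dist1 X₂ + dist1 X₃ + dist1 X₄ := by gcongr; exact GaugeGroup.dist1_mul_le _ _
  linarith [hm, e1, e2, e3]

/-- ★ **The plaquette Lipschitz bound on an `r`-link-tube** (PROVED): if every bond variable of `V` is within `r` of that of `W` (`|W(b)⁻¹V(b) − 1| < r`), then
`|V(∂p) − 1| < |W(∂p) − 1| + 4r` for every plaquette `p`. [cite: Balaban1985Averaging, (9) p.19 and (19) p.21] -/
theorem dist1_plaqHol_lt_of_linkClose (W V : GaugeField P j G) {r : ℝ}
    (h : ∀ b : PBond P j, dist1 ((W b)⁻¹ * V b) < r) (p : Plaq P j) :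
    dist1 (GaugeField.plaqHol V p) < dist1 (GaugeField.plaqHol W p) + 4 * r :=
  dist1_word_lt_of_close _ _ _ _ _ _ _ _ (h _) (h _) (h _) (h _)

/-- Corollary: on the `r`-link-tube around `W`, a plaquette margin `4r` for `W` gives the window for `V`. [folklore] -/
theorem plaqSmall_of_linkClose (W V : GaugeField P j G) {r θ : ℝ}
    (h : ∀ b : PBond P j, dist1 ((W b)⁻¹ * V b) < r) (hW : PlaqSmall (θ - 4 * r) W) : PlaqSmall θ V := by
  intro p
  have := dist1_plaqHol_lt_of_linkClose W V h p
  have hWp := hW p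
  linarith

/-- The centre of a tube lies in it: `|W(b)⁻¹W(b) − 1| = 0 < r`. [folklore] -/
theorem linkClose_self (W : GaugeField P j G) {r : ℝ} (hr : 0 < r) : ∀ b : PBond P j, dist1 ((W b)⁻¹ * W b) < r := by
  intro b; simpa [GaugeGroup.dist1_one] using hr

end Lipschitz

/-! ## §4 THE DOOR: PERS₁∘ ⟸ GEOM∘ + TUBE∘ (PROVED) -/

section Door

/-- ★ **PERS₁∘ ⟸ GEOM∘ + TUBE∘** (PROVED): common fraction `c ≤ min c₀`, thresholds `max pS`, couplings `min γ₁ (and ≤ 1)`; at level `J`, GEOM∘ gives the margin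
`r` and the section `σ` (admissible for TUBE∘ since `θ_{J+1}(c·b₀) − 4r ≤ θ_{J+1}(b₀)`, ✓`θBal_mul_le`); TUBE∘ gives `q`; the tube event inside `D_{J,K}⁻¹B`
lies in `D_{J+1,K}⁻¹W_{J+1}(c·b₀)` by ✓`plaqSmall_of_linkClose`, and monotonicity of `Gibbs_K` finishes. [cite: Balaban1985UV3, (7) p.257 and (38)-(40) p.266] -/
theorem oneLevelPersistence_of_geom_tube : InteriorSectionCan → SectionTubeMassIntCan → OneLevelPersistenceIntCan := by
  intro hG hT L
  obtain ⟨c₁, hc₁, hc₁1, H1⟩ := hG L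
  obtain ⟨c₂, hc₂, -, H2⟩ := hT L
  refine ⟨min c₁ c₂, lt_min hc₁ hc₂, (min_le_left _ _).trans hc₁1, fun c hc hcle => ?_⟩
  have hc1 : c ≤ 1 := (hcle.trans (min_le_left _ _)).trans hc₁1
  obtain ⟨pS₁, H1⟩ := H1 c hc (hcle.trans (min_le_left _ _))
  obtain ⟨pS₂, H2⟩ := H2 c hc (hcle.trans (min_le_right _ _))
  refine ⟨max pS₁ pS₂, fun b₀ p₀ hb hpS hp => ?_⟩
  obtain ⟨γ₁, hγ₁, H1⟩ := H1 b₀ p₀ hb ((le_max_left _ _).trans hpS) hp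
  obtain ⟨γ₂, hγ₂, H2⟩ := H2 b₀ p₀ hb ((le_max_right _ _).trans hpS) hp
  refine ⟨min (min γ₁ γ₂) 1, lt_min (lt_min hγ₁ hγ₂) one_pos, fun F γ hFL hγ hγle J => ?_⟩
  have hγ1 : γ ≤ 1 := hγle.trans (min_le_right _ _)
  have hL1 : 1 ≤ F.L := F.hL.2.le
  obtain ⟨r, hr, σ, hσm, hσ⟩ := H1 F γ hFL hγ (hγle.trans ((min_le_left _ _).trans (min_le_left _ _))) J
  have HT := H2 F γ hFL hγ (hγle.trans ((min_le_left _ _).trans (min_le_right _ _))) J r hr σ hσm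
  -- admissibility of the section for TUBE∘: small-field values
  have hθ : θBal F.L γ (c * b₀) p₀ (J + 1) - 4 * r ≤ θBal F.L γ b₀ p₀ (J + 1) := by
    have := θBal_mul_le hL1 hγ hγ1 hb hc1 p₀ (J + 1)
    linarith
  have hadm : ∀ U : GaugeField (F.P J) 0 (Matrix.specialUnitaryGroup (Fin 2) ℂ), PlaqSmall (θBal F.L γ (c * b₀) p₀ J) U →
      descendTo F ℰp J (J + 1) (Nat.le_succ J) (σ U) = U ∧ PlaqSmall (θBal F.L γ b₀ p₀ (J + 1)) (σ U) := by
    intro U hU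
    obtain ⟨h1, h2⟩ := hσ U hU
    exact ⟨h1, T3PrintedMinimiserExistence.plaqSmall_of_le hθ h2⟩
  obtain ⟨q, hq, HK⟩ := HT hadm
  refine ⟨q, hq, fun K hJK B hBm hBW => ?_⟩
  refine (HK K hJK B hBm hBW).trans (measure_mono ?_)
  rintro V ⟨hVB, hVt⟩
  refine ⟨hVB, ?_⟩
  -- the datum is interior, the section has the margin, the tube transfers it
  have hU : PlaqSmall (θBal F.L γ (c * b₀) p₀ J) (descendTo F ℰp J K ((Nat.le_succ J).trans hJK) V) := hBW hVB
  have hσU := (hσ _ hU).2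
  exact plaqSmall_of_linkClose _ _ hVt hσU

end Door

/-! ## §5 THE STUBS (2, both NEW) and the by-name concluder -/

/-- STUB (NEW) · GEOM∘ — deterministic interior section of the one-step averaging with plaquette margin. -/
theorem stub_interiorSectionCan : InteriorSectionCan := by
  sorry

/-- STUB (NEW) · TUBE∘ — `K`-uniform conditional mass of link-tubes around small-field sections. -/
theorem stub_sectionTubeMassIntCan : SectionTubeMassIntCan := by
  sorry

/-- ★ THE BY-NAME CONCLUDER: PERS₁∘ `OneLevelPersistenceIntCan` (LINE g22-2's stub, text byte-identical) from the two stubs. -/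
theorem oneLevelPersistenceIntCan_of_stubs : OneLevelPersistenceIntCan :=
  oneLevelPersistence_of_geom_tube stub_interiorSectionCan stub_sectionTubeMassIntCan

end Summit.QuantumFields.YangMills.Cruxes.FluctuationComparisonRegPrIntL.RunPairOrgan.PersistenceGeometry

end
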